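import Literature.Analysis.FluidPDE.NSSereginDecaySliceTerms
import Literature.Analysis.FluidPDE.NSSereginDecayEnergyFromZero
import Literature.Analysis.FluidPDE.DistributionalToWeak
import HarnessLib

/-!
# Seregin's Lemma B.6: the slice estimate from the local energy inequality (B.2.7)–(B.2.22)

Analysis/FluidPDE proof file (theorems only) on the discharge path of
`Literature.Analysis.FluidPDE.seregin2014_limit_decay` (Seregin 2014, App. B, Lemma B.6). For
a local energy solution `(u, p)` in the sense of Seregin's Def. B.1 (the tree's clauses of
`seregin2014_limit_decay`) the local energy inequality (B.1.10) tested with the cut-off weight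
`ψ_d = χ_R² φ₀(d − ·)` from the initial time (`ae_lintegral_sq_mul_add_grad_le_datum_add_integral_of_suitable`,
i.e. (B.2.7) with the dissipation kept) is combined with the term bounds (B.2.8)–(B.2.22) of
`NSSereginDecaySliceTerms` (the gauge constant of the pressure expansion (B.1.9) drops out of
`I₄` slice-wise since a.e. slice is weakly divergence free): for every centre `d` and a.e.
`s ∈ (0,T)`,
`E_d(s) + 2ν D_d(s) ≤ K (N + R⁻¹ + ∫₀ˢ α_R + γ_R(s)^{2/3})`, `K = K(ν, T, C, φ₀)`,
where `N` bounds `sup_{x₁} ∫_{B(x₁,1)∖B(0,R)} |a|²` (this is `c‖χ_R a‖²_{L_{2,unif}}`, (B.2.8)).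

## References

* G. Seregin, *Lecture Notes on Regularity Theory for the Navier–Stokes Equations* (2014),
  doi:10.1142/9314, App. B, proof of Lemma B.6, (B.2.7)–(B.2.22), PDF pp. 153–156. Bib key
  `Seregin2014`.
-/

noncomputable section

open MeasureTheory TopologicalSpace Set Function Filter Metric
open _root_.Topology
open scoped ENNReal NNReal RealInnerProductSpace Laplacian

namespace Literature.Analysis.FluidPDE

/-! ### Small tools -/

/-- `(0,T) = ⋃ₘ (0, T(m+1)/(m+2))`. [folklore] -/
theorem Ioo_eq_iUnion_Ioo_approx {T : ℝ} (hT : 0 < T) :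
    Ioo (0 : ℝ) T = ⋃ m : ℕ, Ioo (0 : ℝ) (T * ((m + 1 : ℝ) / (m + 2))) := by
  ext t
  simp only [mem_Ioo, mem_iUnion]
  constructor
  · rintro ⟨ht0, htT⟩
    obtain ⟨m, hm⟩ := exists_nat_gt (T / (T - t))
    refine ⟨m, ht0, ?_⟩
    have hTt : 0 < T - t := by linarith
    have hm' : T < (m : ℝ) * (T - t) := by
      have := (div_lt_iff₀ hTt).1 hm
      linarith
    have h2 : (0 : ℝ) < (m : ℝ) + 2 := by positivity
    rw [← mul_div_assoc, lt_div_iff₀ h2]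
    nlinarith
  · rintro ⟨m, ht0, htm⟩
    refine ⟨ht0, htm.trans_le ?_⟩
    have h2 : (0 : ℝ) < (m : ℝ) + 2 := by positivity
    have : ((m : ℝ) + 1) / (m + 2) ≤ 1 := by rw [div_le_one h2]; linarith
    calc T * ((m + 1 : ℝ) / (m + 2)) ≤ T * 1 := mul_le_mul_of_nonneg_left this hT.le
      _ = T := mul_one T


/-- Square integrability on compact cylinders from the every-time unit-ball bound. [folklore] -/
theorem lintegral_cylinder_sq_lt_top_of_unitBall {T : ℝ} {C : ℝ≥0} {u : ℝ → EuclideanSpace ℝ (Fin 3) → EuclideanSpace ℝ (Fin 3)}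
    (huC : ∀ t ∈ Icc 0 T, ∀ x₀ : EuclideanSpace ℝ (Fin 3), ∫⁻ x in ball x₀ 1, ‖u t x‖ₑ ^ 2 ≤ C)
    {K' : Set (EuclideanSpace ℝ (Fin 3))} (hK' : IsCompact K') :
    ∫⁻ z in Ioo 0 T ×ˢ K', ‖uncurry u z‖ₑ ^ 2 < ∞ := by
  obtain ⟨F, hF⟩ := exists_finset_subset_biUnion_ball_one hK'
  have hsub : Ioo 0 T ×ˢ K' ⊆ ⋃ c ∈ F, Ioo 0 T ×ˢ ball c 1 := by
    intro z hz
    have h := hF hz.2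
    simp only [mem_iUnion] at h
    obtain ⟨c, hc, hcz⟩ := h
    exact mem_iUnion₂.2 ⟨c, hc, ⟨hz.1, hcz⟩⟩
  rcases le_or_gt T 0 with hT | hT
  · simp [Ioo_eq_empty_of_le hT]
  refine lt_of_le_of_lt ((lintegral_mono_set hsub).trans
    (lintegral_biUnion_finset_le_card_mul F _ _ fun c _ => lintegral_unitCylinder_sq_le huC le_rfl c)) ?_
  exact ENNReal.mul_lt_top (ENNReal.natCast_lt_top _) (ENNReal.mul_lt_top ENNReal.ofReal_lt_top ENNReal.coe_lt_top)

set_option maxHeartbeats 1600000 in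
/-- **Seregin's Lemma B.6, the slice estimate** ((B.2.7) with (B.2.8)–(B.2.22)): for `ν, T > 0`,
a constant `C` and a bump `φ₀` with `rOut < 3/2` there is `K = K(ν, T, C, φ₀)` such that for every
`(u, p)` satisfying the clauses of Seregin's Def. B.1 on `ℝ³ × (0,T)` with constant `C` (suitable
weak solution with the localised energy inequality, `p ∈ L^{3/2}_loc`, measurable slices with
unit-ball energies `≤ C` on `[0,T]`, a weak spatial gradient with unit-cylinder energies `≤ C`,
the datum `a ∈ E₂` attained in `L²_loc`, and the local pressure expansion at every centre and
radius), every `R ≥ 4`, every `N` with `∫_{B(x₁,1)∖B(0,R)} |a|² ≤ N` for all `x₁`, and every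
centre `d`: for a.e. `s ∈ (0,T)`,
`∫ψ_d|u(s)|² + 2ν∫₀ˢ∫_{B(d,2)} ψ_d|∇u|² ≤ K (N + R⁻¹ + ∫₀ˢ α_R + γ_R(s)^{2/3})`
(`ψ_d = χ_R² φ₀(d − ·)`; `α_R(τ) = ‖χ_R u(τ)‖²_{L²_uloc}`, `γ_R(s) = sup_c ∫₀ˢ∫_{B(c,1)}|χ_R u|³`).
Proof as printed: the local energy inequality (B.1.10)/(B.2.7) with `ψ = ψ_d` from `t = 0`
(signed form, dissipation kept), `I₁ ≤ c‖χ_R a‖²` (B.2.8), `I₂, I₃` by (B.2.9), (B.2.11), and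
`I₄` by (B.2.12)–(B.2.22) after removing the gauge constant of (B.1.9) slice-wise (a.e. slice is
weakly divergence free). [cite: Seregin2014, App. B, proof of Lemma B.6, (B.2.7)–(B.2.22), PDF pp. 153–156] -/
theorem exists_seregin_sliceEstimate (ν T : ℝ) (C : ℝ≥0) (hν : 0 < ν) (hT : 0 < T)
    (φ₀ : ContDiffBump (0 : EuclideanSpace ℝ (Fin 3))) (hrOut : φ₀.rOut < 3 / 2) :
    ∃ K : ℝ≥0, ∀ (a : EuclideanSpace ℝ (Fin 3) → EuclideanSpace ℝ (Fin 3)) (u : ℝ → EuclideanSpace ℝ (Fin 3) → EuclideanSpace ℝ (Fin 3)) (p : ℝ → EuclideanSpace ℝ (Fin 3) → ℝ)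
      (G : ℝ → EuclideanSpace ℝ (Fin 3) → EuclideanSpace ℝ (Fin 3) →L[ℝ] EuclideanSpace ℝ (Fin 3)),
      MemE2 a →
      IsSuitableWeakSolutionOn (slab (EuclideanSpace ℝ (Fin 3)) (Ioo 0 T) isOpen_Ioo) ν 0 u p →
      (∀ K' : Set (EuclideanSpace ℝ (Fin 3)), IsCompact K' → ∫⁻ z in Ioo 0 T ×ˢ K', ‖p z.1 z.2‖ₑ ^ (3 / 2 : ℝ) < ∞) →
      (∀ t ∈ Icc 0 T, AEStronglyMeasurable (u t) volume) →
      (∀ t ∈ Icc 0 T, ∀ x₀ : EuclideanSpace ℝ (Fin 3), ∫⁻ x in ball x₀ 1, ‖u t x‖ₑ ^ 2 ≤ C) →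
      HasWeakSpatialGradientOn (slab (EuclideanSpace ℝ (Fin 3)) (Ioo 0 T) isOpen_Ioo) u G →
      (∀ x₀ : EuclideanSpace ℝ (Fin 3), ∫⁻ z in Ioo 0 T ×ˢ ball x₀ 1, ENNReal.ofReal (frobeniusNormSq (G z.1 z.2)) ≤ C) →
      (∀ K' : Set (EuclideanSpace ℝ (Fin 3)), IsCompact K' →
        Tendsto (fun t => ∫⁻ x in K', ‖u t x - a x‖ₑ ^ 2) (𝓝[>] 0) (𝓝 0)) →
      (∀ (x₀ : EuclideanSpace ℝ (Fin 3)) (r : ℝ), 0 < r → ∀ᵐ t ∂(volume.restrict (Ioo (0 : ℝ) T)), ∃ κ : ℝ,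
        ∀ᵐ x ∂(volume.restrict (ball x₀ r)),
          p t x = localPressureNear x₀ r u t x + localPressureFar x₀ r u t x + κ) →
      ∀ (R : ℝ), 4 ≤ R → ∀ (N : ℝ≥0),
      (∀ x₁ : EuclideanSpace ℝ (Fin 3), ∫⁻ x in ball x₁ 1 \ ball (0 : EuclideanSpace ℝ (Fin 3)) R, ‖a x‖ₑ ^ 2 ≤ N) →
      ∀ d : EuclideanSpace ℝ (Fin 3), ∀ᵐ s ∂(volume.restrict (Ioo 0 T)),
        (∫⁻ x, ‖u s x‖ₑ ^ 2 * ENNReal.ofReal (sereginWeight φ₀ R d x)) +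
          ENNReal.ofReal (2 * ν) * ∫⁻ z in Ioo 0 s ×ˢ ball d 2,
            ENNReal.ofReal (frobeniusNormSq (G z.1 z.2)) * ENNReal.ofReal (sereginWeight φ₀ R d z.2)
        ≤ K * (N + ENNReal.ofReal R⁻¹ +
            (∫⁻ τ in Ioo 0 s, ulocEnergy (fun x => (1 - cutoff R x) • u τ x)) +
            (⨆ c : EuclideanSpace ℝ (Fin 3), ∫⁻ z in Ioo 0 s ×ˢ ball c 1,
              ‖(1 - cutoff R z.2) • u z.1 z.2‖ₑ ^ 3) ^ (2 / 3 : ℝ)) := by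
  -- constants
  obtain ⟨KA, hKA⟩ := exists_termI₂I₃_le T C hν.le φ₀ hrOut
  obtain ⟨KN, hKN⟩ := exists_nearTerm_le T C φ₀ hrOut
  obtain ⟨KF, hKF⟩ := exists_farTerm_le T C φ₀ hrOut
  obtain ⟨nb, hnb⟩ := exists_lintegral_ball_le_mul (3 / 2)
  obtain ⟨nc2, hnc2⟩ := exists_lintegral_cylinder_le_mul 2
  obtain ⟨Γ₁, hΓ₁⟩ := exists_lintegral_unitCylinder_cube_le T C
  obtain ⟨B₁, hB₁0, hB₁⟩ := exists_norm_fderiv_bump_comp_sub_le φ₀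
  obtain ⟨C₁, hC₁0, hC₁⟩ := exists_norm_fderiv_cutoff_le (E := EuclideanSpace ℝ (Fin 3))
  obtain ⟨KΔ, hKΔ0, hKΔ⟩ := exists_abs_laplacian_sereginWeight_le φ₀
  refine ⟨nb + KA + 2 * (KN + KF), ?_⟩
  intro a u p G ha hsuit hp hum huC hG huG hinit hexp R hR N hN d
  have hR1 : 1 ≤ R := by linarith
  have hRpos : 0 < R := by linarith
  -- the weight
  set ψ : EuclideanSpace ℝ (Fin 3) → ℝ := sereginWeight φ₀ R d with hψ
  have hψc : ContDiff ℝ (⊤ : ℕ∞) ψ := contDiff_sereginWeight φ₀ R d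
  have hψ0 : ∀ x, 0 ≤ ψ x := sereginWeight_nonneg φ₀ R d
  have hball : closedBall d φ₀.rOut ⊆ ball d (3 / 2) := closedBall_subset_ball hrOut
  have hψs : tsupport ψ ⊆ ball d 2 :=
    ((tsupport_sereginWeight_subset φ₀ R d).trans hball).trans (ball_subset_ball (by norm_num))
  have hψcs : HasCompactSupport ψ := hasCompactSupport_sereginWeight φ₀ R d
  have hψtest : FunctionSpaces.IsTestFunctionOn (⊤ : Opens (EuclideanSpace ℝ (Fin 3))) ψ := ⟨hψc, hψcs, by simp⟩
  have hgrad0 : ∀ x ∉ ball d (3 / 2), gradient ψ x = 0 := fun x hx =>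
    gradient_sereginWeight_eq_zero φ₀ hrOut R d hx
  have hgradM : ∀ x, ‖gradient ψ x‖ ≤ B₁ + 2 * C₁ := by
    intro x
    rw [norm_gradient_eq_norm_fderiv]
    have h := norm_fderiv_sereginWeight_le φ₀ hB₁ (hC₁ R hRpos) d x
    have hχ := one_sub_cutoff_mem_Icc R x
    have h1 : (1 - cutoff R x) ^ 2 * B₁ ≤ 1 * B₁ :=
      mul_le_mul_of_nonneg_right (by nlinarith [hχ.1, hχ.2]) hB₁0
    have h2 : 2 * (1 - cutoff R x) * (C₁ / R) ≤ 2 * 1 * (C₁ / 1) := by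
      have hCR : C₁ / R ≤ C₁ / 1 := div_le_div_of_nonneg_left hC₁0 one_pos hR1
      have : 2 * (1 - cutoff R x) ≤ 2 * 1 := by linarith [hχ.2]
      exact mul_le_mul this hCR (div_nonneg hC₁0 hRpos.le) (by norm_num)
    linarith
  have hΔM : ∀ x, |(Δ ψ) x| ≤ 2 * KΔ := by
    intro x
    have h := hKΔ R hR1 d x
    have hχ := one_sub_cutoff_mem_Icc R x
    have : (1 - cutoff R x) ^ 2 + 1 / R ≤ 2 := by
      have h1 : (1 - cutoff R x) ^ 2 ≤ 1 := by nlinarith [hχ.1, hχ.2]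
      have h2 : 1 / R ≤ 1 := by rw [div_le_one hRpos]; exact hR1
      linarith
    calc |(Δ ψ) x| ≤ KΔ * ((1 - cutoff R x) ^ 2 + 1 / R) := h
      _ ≤ KΔ * 2 := mul_le_mul_of_nonneg_left this hKΔ0
      _ = 2 * KΔ := mul_comm _ _
  -- measurability of `u` on the strip and basic integrability facts
  have hmeas : AEStronglyMeasurable (uncurry u) (volume.restrict (Ioo 0 T ×ˢ (univ : Set (EuclideanSpace ℝ (Fin 3))))) :=
    hsuit.distributional.1.aestronglyMeasurable
  have hsq : ∀ K' : Set (EuclideanSpace ℝ (Fin 3)), IsCompact K' → ∫⁻ z in Ioo 0 T ×ˢ K', ‖uncurry u z‖ₑ ^ 2 < ∞ :=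
    fun K' hK' => lintegral_cylinder_sq_lt_top_of_unitBall huC hK'
  have hm₀ : AEStronglyMeasurable a volume := ha.aestronglyMeasurable
  set cylT : Set (ℝ × EuclideanSpace ℝ (Fin 3)) := Ioo 0 T ×ˢ ball d 2 with hcylT
  have hmu_T : AEStronglyMeasurable (uncurry u) (volume.restrict cylT) :=
    hmeas.mono_measure (Measure.restrict_mono (prod_mono Subset.rfl (subset_univ _)) le_rfl)
  have hcube_T : ∫⁻ z in cylT, ‖u z.1 z.2‖ₑ ^ 3 ≤ (nc2 : ℝ≥0∞) * Γ₁ :=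
    hnc2 (Ioo 0 T) (fun z => ‖u z.1 z.2‖ₑ ^ 3) Γ₁ (fun c => hΓ₁ u G hG huC huG T le_rfl c) d
  have hcube_lt : ∫⁻ z in cylT, ‖u z.1 z.2‖ₑ ^ 3 < ⊤ :=
    lt_of_le_of_lt hcube_T (ENNReal.mul_lt_top (ENNReal.natCast_lt_top _) ENNReal.coe_lt_top)
  have hu3 : IntegrableOn (fun z : ℝ × EuclideanSpace ℝ (Fin 3) => ‖u z.1 z.2‖ ^ 3) cylT volume := by
    refine ⟨(continuous_norm.pow 3).comp_aestronglyMeasurable hmu_T, hasFiniteIntegral_iff_enorm.2 ?_⟩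
    refine lt_of_le_of_lt (lintegral_mono fun z => le_of_eq ?_) hcube_lt
    rw [Real.enorm_eq_ofReal (by positivity), ENNReal.ofReal_pow (norm_nonneg _), ofReal_norm]
  -- `L³` and `L^{3/2}` memberships on the cylinder, and the integrability of the pressure pairing
  have hu_L3 : MemLp (uncurry u) 3 (volume.restrict cylT) := by
    refine ⟨hmu_T, ?_⟩
    rw [eLpNorm_eq_lintegral_rpow_enorm_toReal (by norm_num) (by norm_num), ENNReal.toReal_ofNat]
    refine ENNReal.rpow_lt_top_of_nonneg (by norm_num) (lt_top_iff_ne_top.1 ?_)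
    have e : ∫⁻ z, ‖uncurry u z‖ₑ ^ (3 : ℝ) ∂(volume.restrict cylT) = ∫⁻ z in cylT, ‖u z.1 z.2‖ₑ ^ 3 :=
      lintegral_congr fun z => by
        rw [show (3 : ℝ) = ((3 : ℕ) : ℝ) by norm_num, ENNReal.rpow_natCast]; rfl
    rw [e]; exact hcube_lt
  have hp_L32 : MemLp (fun z : ℝ × EuclideanSpace ℝ (Fin 3) => p z.1 z.2) (3 / 2 : ℝ≥0∞) (volume.restrict cylT) := by
    have hpm : AEStronglyMeasurable (uncurry p) (volume.restrict cylT) :=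
      hsuit.distributional.2.2.1.aestronglyMeasurable.mono_measure
        (Measure.restrict_mono (prod_mono Subset.rfl (subset_univ _)) le_rfl)
    refine ⟨hpm, eLpNorm_threeHalves_lt_top_of_lintegral (lt_top_iff_ne_top.1 ?_)⟩
    calc ∫⁻ z in cylT, ‖p z.1 z.2‖ₑ ^ (3 / 2 : ℝ)
        ≤ ∫⁻ z in Ioo 0 T ×ˢ closedBall d 2, ‖p z.1 z.2‖ₑ ^ (3 / 2 : ℝ) :=
          lintegral_mono_set (prod_mono Subset.rfl ball_subset_closedBall)
      _ < ⊤ := hp _ (isCompact_closedBall d 2)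
  have hgradc : Continuous (gradient ψ) := by
    have : gradient ψ = fun x => (InnerProductSpace.toDual ℝ (EuclideanSpace ℝ (Fin 3))).symm (fderiv ℝ ψ x) := rfl
    rw [this]
    exact (InnerProductSpace.toDual ℝ (EuclideanSpace ℝ (Fin 3))).symm.continuous.comp (hψc.continuous_fderiv (by simp))
  have hg_m : AEStronglyMeasurable (fun z : ℝ × EuclideanSpace ℝ (Fin 3) => ⟪u z.1 z.2, gradient ψ z.2⟫) (volume.restrict cylT) :=
    hmu_T.inner (𝕜 := ℝ) (hgradc.comp continuous_snd).aestronglyMeasurable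
  have hg_L3 : MemLp (fun z : ℝ × EuclideanSpace ℝ (Fin 3) => ⟪u z.1 z.2, gradient ψ z.2⟫) 3 (volume.restrict cylT) := by
    refine hu_L3.of_le_mul (c := B₁ + 2 * C₁) hg_m (Eventually.of_forall fun z => ?_)
    calc ‖⟪u z.1 z.2, gradient ψ z.2⟫‖ ≤ ‖u z.1 z.2‖ * ‖gradient ψ z.2‖ := norm_inner_le_norm _ _
      _ ≤ ‖u z.1 z.2‖ * (B₁ + 2 * C₁) := mul_le_mul_of_nonneg_left (hgradM z.2) (norm_nonneg _)
      _ = (B₁ + 2 * C₁) * ‖uncurry u z‖ := by rw [mul_comm]; rfl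
  have hπv : IntegrableOn (fun z : ℝ × EuclideanSpace ℝ (Fin 3) => p z.1 z.2 * ⟪u z.1 z.2, gradient ψ z.2⟫) cylT volume := by
    haveI : ENNReal.HolderTriple (3 / 2 : ℝ≥0∞) 3 1 := by
      refine ⟨?_⟩
      have e1 : (3 / 2 : ℝ≥0∞) = ENNReal.ofReal (3 / 2) := by
        rw [ENNReal.ofReal_div_of_pos (by norm_num)]; simp
      have e2 : (3 : ℝ≥0∞) = ENNReal.ofReal 3 := by simp
      rw [e1, e2, ← ENNReal.ofReal_inv_of_pos (by norm_num), ← ENNReal.ofReal_inv_of_pos (by norm_num),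
        ← ENNReal.ofReal_add (by positivity) (by positivity), inv_one]
      norm_num
    exact hp_L32.integrable_mul hg_L3
  -- weakly divergence-free slices
  have hweak : IsWeakNSSolutionOn T ν 0 a u :=
    IsDistributionalNSSolutionOn.isWeakNSSolutionOn_datum hsuit.distributional hsq
      (fun K _ => show IntegrableOn (fun _ : ℝ × EuclideanSpace ℝ (Fin 3) => (0 : EuclideanSpace ℝ (Fin 3))) (Ioo 0 T ×ˢ K) volume from
        integrableOn_zero) hm₀ hinit
  have hdivae : ∀ᵐ τ ∂(volume.restrict (Ioo 0 T)), ∫ x, ⟪u τ x, gradient ψ x⟫ = 0 :=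
    hweak.ae_isWeaklyDivFree.mono fun τ hτ => hτ ψ hψtest
  -- slice integrability of the pressure pairing and the expansion, a.e. in time
  have hprodT : (volume.restrict cylT : Measure (ℝ × EuclideanSpace ℝ (Fin 3))) =
      ((volume : Measure ℝ).restrict (Ioo 0 T)).prod ((volume : Measure (EuclideanSpace ℝ (Fin 3))).restrict (ball d 2)) := by
    rw [hcylT, Measure.prod_restrict, ← Measure.volume_eq_prod]
  have hPslice : ∀ᵐ τ ∂(volume.restrict (Ioo 0 T)),
      Integrable (fun x => p τ x * ⟪u τ x, gradient ψ x⟫) (volume.restrict (ball d 2)) := by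
    have h : Integrable (fun z : ℝ × EuclideanSpace ℝ (Fin 3) => p z.1 z.2 * ⟪u z.1 z.2, gradient ψ z.2⟫)
        (((volume : Measure ℝ).restrict (Ioo 0 T)).prod ((volume : Measure (EuclideanSpace ℝ (Fin 3))).restrict (ball d 2))) := by
      rw [← hprodT]; exact hπv
    exact h.prod_right_ae
  have hexp2 := hexp d 2 two_pos
  -- every slice of `[0,T]`: `⟪u, ∇ψ⟫` is integrable, the near field is measurable
  have hvint : ∀ τ ∈ Icc 0 T, Integrable (fun x => ⟪u τ x, gradient ψ x⟫) volume := by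
    intro τ hτ
    have hfin : ∫⁻ x in ball d (3 / 2), ‖u τ x‖ₑ ^ 2 < ⊤ :=
      lt_of_le_of_lt (hnb (fun x => ‖u τ x‖ₑ ^ 2) C (huC τ hτ) d)
        (ENNReal.mul_lt_top (ENNReal.natCast_lt_top _) ENNReal.coe_lt_top)
    haveI : IsFiniteMeasure (volume.restrict (ball d (3 / 2))) :=
      isFiniteMeasure_restrict.2 measure_ball_lt_top.ne
    have hL2 : MemLp (u τ) 2 (volume.restrict (ball d (3 / 2))) := by
      refine ⟨(hum τ hτ).restrict, ?_⟩
      rw [eLpNorm_eq_lintegral_rpow_enorm_toReal (by norm_num) (by norm_num), ENNReal.toReal_ofNat]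
      refine ENNReal.rpow_lt_top_of_nonneg (by norm_num) (lt_top_iff_ne_top.1 ?_)
      have e : ∫⁻ x, ‖u τ x‖ₑ ^ (2 : ℝ) ∂(volume.restrict (ball d (3 / 2))) = ∫⁻ x in ball d (3 / 2), ‖u τ x‖ₑ ^ 2 :=
        lintegral_congr fun x => by rw [show (2 : ℝ) = ((2 : ℕ) : ℝ) by norm_num, ENNReal.rpow_natCast]
      rw [e]; exact hfin
    have hL1 : Integrable (u τ) (volume.restrict (ball d (3 / 2))) := hL2.integrable one_le_two
    have hon : IntegrableOn (fun x => ⟪u τ x, gradient ψ x⟫) (ball d (3 / 2)) volume := by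
      refine (hL1.norm.const_mul (B₁ + 2 * C₁)).mono' ((hum τ hτ).restrict.inner (𝕜 := ℝ)
        hgradc.aestronglyMeasurable.restrict) (Eventually.of_forall fun x => ?_)
      calc ‖⟪u τ x, gradient ψ x⟫‖ ≤ ‖u τ x‖ * ‖gradient ψ x‖ := norm_inner_le_norm _ _
        _ ≤ ‖u τ x‖ * (B₁ + 2 * C₁) := mul_le_mul_of_nonneg_left (hgradM x) (norm_nonneg _)
        _ = (B₁ + 2 * C₁) * ‖u τ x‖ := mul_comm _ _
    exact hon.integrable_of_forall_notMem_eq_zero fun x hx => by rw [hgrad0 x hx, inner_zero_right]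
  have hnearm : ∀ τ ∈ Icc 0 T, AEStronglyMeasurable (localPressureNear d 2 u τ) volume := by
    intro τ hτ
    refine aestronglyMeasurable_localPressureNear_slice (hum τ hτ) ?_
    obtain ⟨n4, hn4⟩ := exists_lintegral_ball_le_mul (2 * 2)
    exact lt_of_le_of_lt (hn4 (fun x => ‖u τ x‖ₑ ^ 2) C (huC τ hτ) d)
      (ENNReal.mul_lt_top (ENNReal.natCast_lt_top _) ENNReal.coe_lt_top)
  -- the local energy inequality from `t = 0` with `ψ = ψ_d`, a.e. in `(0,T)`
  set RHS : ℝ → ℝ≥0∞ := fun s => ENNReal.ofReal ((∫ x, ‖a x‖ ^ 2 * ψ x) +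
    ∫ z in Ioo 0 s ×ˢ ball d 2, (‖u z.1 z.2‖ ^ 2 * (ν * Δ ψ z.2) +
      (‖u z.1 z.2‖ ^ 2 + 2 * p z.1 z.2) * ⟪u z.1 z.2, gradient ψ z.2⟫)) with hRHS
  set LHS : ℝ → ℝ≥0∞ := fun s => (∫⁻ x, ‖u s x‖ₑ ^ 2 * ENNReal.ofReal (ψ x)) +
    ENNReal.ofReal (2 * ν) * ∫⁻ z in Ioo 0 s ×ˢ ball d 2,
      ENNReal.ofReal (frobeniusNormSq (G z.1 z.2)) * ENNReal.ofReal (ψ z.2) with hLHS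
  have hLEI : ∀ᵐ s ∂(volume.restrict (Ioo 0 T)), LHS s ≤ RHS s := by
    rw [Ioo_eq_iUnion_Ioo_approx hT, ae_restrict_iUnion_iff]
    intro m
    have h2 : (0 : ℝ) < (m : ℝ) + 2 := by positivity
    have hT₁ : 0 < T * ((m + 1 : ℝ) / (m + 2)) := mul_pos hT (div_pos (by positivity) h2)
    have hT₁T : T * ((m + 1 : ℝ) / (m + 2)) < T := by
      have : ((m : ℝ) + 1) / (m + 2) < 1 := by rw [div_lt_one h2]; linarith
      calc T * ((m + 1 : ℝ) / (m + 2)) < T * 1 := mul_lt_mul_of_pos_left this hT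
        _ = T := mul_one T
    exact ae_lintegral_sq_mul_add_grad_le_datum_add_integral_of_suitable hν.le hT₁ hT₁T hsuit hmeas hsq
      hinit hm₀ hG d hu3 hψc hψs hψ0 hπv
  -- the datum term `I₁ ≤ n N`
  have hI₁ : ENNReal.ofReal (∫ x, ‖a x‖ ^ 2 * ψ x) ≤ (nb : ℝ≥0∞) * N := by
    have hχ0R : ∀ x ∈ ball (0 : EuclideanSpace ℝ (Fin 3)) R, 1 - cutoff R x = 0 := fun x hx => by
      rw [cutoff_eq_one hRpos (le_of_lt (by rwa [mem_ball_zero_iff] at hx)), sub_self]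
    calc ENNReal.ofReal (∫ x, ‖a x‖ ^ 2 * ψ x) ≤ ‖∫ x, ‖a x‖ ^ 2 * ψ x‖ₑ := by
          rw [Real.enorm_eq_ofReal_abs]; exact ENNReal.ofReal_le_ofReal (le_abs_self _)
      _ ≤ ∫⁻ x, ‖‖a x‖ ^ 2 * ψ x‖ₑ := enorm_integral_le_lintegral_enorm _
      _ ≤ ∫⁻ x, (ball d (3 / 2)).indicator (fun x => ENNReal.ofReal ((1 - cutoff R x) ^ 2) * ‖a x‖ₑ ^ 2) x := by
          refine lintegral_mono fun x => ?_
          by_cases hx : x ∈ ball d (3 / 2)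
          · rw [indicator_of_mem hx, Real.enorm_eq_ofReal (mul_nonneg (sq_nonneg _) (hψ0 x)),
              ENNReal.ofReal_mul (sq_nonneg _), ENNReal.ofReal_pow (norm_nonneg _), ofReal_norm, mul_comm]
            exact mul_le_mul' (ENNReal.ofReal_le_ofReal (sereginWeight_le_sq φ₀ R d x)) le_rfl
          · have hx' : x ∉ closedBall d φ₀.rOut := fun h => hx (hball h)
            have h0 : ψ x = 0 := by
              rw [hψ]; exact sereginWeight_eq_zero_of_not_mem φ₀ R fun h => hx' (ball_subset_closedBall h)
            rw [indicator_of_notMem hx, h0, mul_zero, enorm_zero]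
      _ = ∫⁻ x in ball d (3 / 2), ENNReal.ofReal ((1 - cutoff R x) ^ 2) * ‖a x‖ₑ ^ 2 :=
          lintegral_indicator measurableSet_ball _
      _ ≤ (nb : ℝ≥0∞) * N := by
          refine hnb (fun x => ENNReal.ofReal ((1 - cutoff R x) ^ 2) * ‖a x‖ₑ ^ 2) N (fun c => ?_) d
          calc ∫⁻ x in ball c 1, ENNReal.ofReal ((1 - cutoff R x) ^ 2) * ‖a x‖ₑ ^ 2
              ≤ ∫⁻ x in ball c 1, (ball (0 : EuclideanSpace ℝ (Fin 3)) R)ᶜ.indicator (fun x => ‖a x‖ₑ ^ 2) x := by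
                refine lintegral_mono fun x => ?_
                by_cases hx : x ∈ ball (0 : EuclideanSpace ℝ (Fin 3)) R
                · rw [hχ0R x hx]; simp
                · rw [indicator_of_mem (mem_compl hx)]
                  calc ENNReal.ofReal ((1 - cutoff R x) ^ 2) * ‖a x‖ₑ ^ 2 ≤ 1 * ‖a x‖ₑ ^ 2 := by
                        gcongr; exact ENNReal.ofReal_le_one.2 (one_sub_cutoff_sq_le_one R x)
                    _ = ‖a x‖ₑ ^ 2 := one_mul _
            _ = ∫⁻ x in ball c 1 \ ball (0 : EuclideanSpace ℝ (Fin 3)) R, ‖a x‖ₑ ^ 2 := by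
                rw [lintegral_indicator measurableSet_ball.compl, Measure.restrict_restrict measurableSet_ball.compl,
                  Set.sdiff_eq_compl_inter]
            _ ≤ N := hN c
  -- the pressure term: `‖∫_{(0,s)×B} p⟪u,∇ψ⟫‖ ≤ KN(R⁻¹ + γ^{2/3}) + KF(R⁻¹ + ∫α)`
  have hQ : ∀ s ∈ Ioo 0 T, ‖∫ z in Ioo 0 s ×ˢ ball d 2, p z.1 z.2 * ⟪u z.1 z.2, gradient ψ z.2⟫‖ₑ ≤
      (KN : ℝ≥0∞) * (ENNReal.ofReal R⁻¹ + (⨆ c : EuclideanSpace ℝ (Fin 3), ∫⁻ z in Ioo 0 s ×ˢ ball c 1,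
          ‖(1 - cutoff R z.2) • u z.1 z.2‖ₑ ^ 3) ^ (2 / 3 : ℝ)) +
        (KF : ℝ≥0∞) * (ENNReal.ofReal R⁻¹ + ∫⁻ τ in Ioo 0 s, ulocEnergy (fun x => (1 - cutoff R x) • u τ x)) := by
    intro s hs
    set cyl : Set (ℝ × EuclideanSpace ℝ (Fin 3)) := Ioo 0 s ×ˢ ball d 2 with hcyl
    have hcyl_sub : cyl ⊆ cylT := prod_mono (Ioo_subset_Ioo le_rfl hs.2.le) Subset.rfl
    have hprod : (volume.restrict cyl : Measure (ℝ × EuclideanSpace ℝ (Fin 3))) =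
        ((volume : Measure ℝ).restrict (Ioo 0 s)).prod ((volume : Measure (EuclideanSpace ℝ (Fin 3))).restrict (ball d 2)) := by
      rw [hcyl, Measure.prod_restrict, ← Measure.volume_eq_prod]
    have hPint : Integrable (fun z : ℝ × EuclideanSpace ℝ (Fin 3) => p z.1 z.2 * ⟪u z.1 z.2, gradient ψ z.2⟫)
        (((volume : Measure ℝ).restrict (Ioo 0 s)).prod ((volume : Measure (EuclideanSpace ℝ (Fin 3))).restrict (ball d 2))) := by
      rw [← hprod]; exact hπv.mono_set hcyl_sub
    set Q : ℝ → ℝ := fun τ => ∫ x in ball d 2, p τ x * ⟪u τ x, gradient ψ x⟫ with hQdef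
    have hFub : ∫ z in cyl, p z.1 z.2 * ⟪u z.1 z.2, gradient ψ z.2⟫ = ∫ τ in Ioo 0 s, Q τ := by
      rw [show (∫ z in cyl, p z.1 z.2 * ⟪u z.1 z.2, gradient ψ z.2⟫) =
        ∫ z, p z.1 z.2 * ⟪u z.1 z.2, gradient ψ z.2⟫ ∂(((volume : Measure ℝ).restrict (Ioo 0 s)).prod
          ((volume : Measure (EuclideanSpace ℝ (Fin 3))).restrict (ball d 2))) by rw [hprod]]
      exact integral_prod _ hPint
    -- measurability of `Q` in time
    have hQm : AEStronglyMeasurable Q (volume.restrict (Ioo 0 s)) := hPint.aestronglyMeasurable.integral_prod_right'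
    -- the far lemma at `s`
    obtain ⟨c₁, c₂, hc₁, hc₂, hfar, hfarint⟩ := hKF u hum huC R hR d s hs.1 hs.2.le
    set αR : ℝ → ℝ≥0∞ := fun τ => ulocEnergy (fun x => (1 - cutoff R x) • u τ x) with hαR
    set FB : ℝ → ℝ≥0∞ := fun τ => c₁ * αR τ + c₂ with hFB
    -- measurability of `α_R` in time
    have hχs : ContDiff ℝ (⊤ : ℕ∞) (fun x : EuclideanSpace ℝ (Fin 3) => 1 - cutoff R x) := contDiff_const.sub (contDiff_cutoff R)
    have hmχu : AEStronglyMeasurable (uncurry fun t x => (1 - cutoff R x) • u t x)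
        (volume.restrict (Ioo 0 T ×ˢ (univ : Set (EuclideanSpace ℝ (Fin 3))))) := by
      have h := hG.smul_left hχs
      rw [slab_eq_prod_top] at h
      exact h.locallyIntegrableOn.aestronglyMeasurable
    have hαm : AEMeasurable αR (volume.restrict (Ioo 0 s)) :=
      (aemeasurable_ulocEnergy_slice hmχu).mono_measure (Measure.restrict_mono (Ioo_subset_Ioo le_rfl hs.2.le) le_rfl)
    have hFBm : AEMeasurable FB (volume.restrict (Ioo 0 s)) := (hαm.const_mul _).add_const _
    -- a.e. `τ`: `‖Q τ‖ ≤ near part + far part`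
    have hQae : ∀ᵐ τ ∂(volume.restrict (Ioo 0 s)), τ ∈ Ioo 0 s →
        ‖Q τ‖ₑ ≤ (∫⁻ x in ball d 2, ‖localPressureNear d 2 u τ x‖ₑ * ‖u τ x‖ₑ * ‖gradient ψ x‖ₑ) + FB τ := by
      have hsub : Ioo (0 : ℝ) s ⊆ Ioo 0 T := Ioo_subset_Ioo le_rfl hs.2.le
      filter_upwards [ae_restrict_of_ae_restrict_of_subset hsub hexp2,
        ae_restrict_of_ae_restrict_of_subset hsub hPslice,
        ae_restrict_of_ae_restrict_of_subset hsub hdivae] with τ hexpτ hPτ hdivτ hτ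
      have hτI : τ ∈ Icc 0 T := ⟨hτ.1.le, hτ.2.le.trans hs.2.le⟩
      obtain ⟨κ, hκ⟩ := hexpτ
      have hpair := enorm_setIntegral_pressure_pairing_le hκ hPτ (hvint τ hτI) hdivτ
        (fun x hx => hgrad0 x fun h => hx (ball_subset_ball (by norm_num) h))
      have hmN : AEMeasurable (fun x => ‖localPressureNear d 2 u τ x‖ₑ * ‖u τ x‖ₑ * ‖gradient ψ x‖ₑ)
          (volume.restrict (ball d 2)) :=
        (((hnearm τ hτI).restrict.enorm.mul (hum τ hτI).restrict.enorm).mul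
          hgradc.aestronglyMeasurable.restrict.enorm)
      calc ‖Q τ‖ₑ ≤ ∫⁻ x in ball d 2, (‖localPressureNear d 2 u τ x‖ₑ + ‖localPressureFar d 2 u τ x‖ₑ) *
            ‖u τ x‖ₑ * ‖gradient ψ x‖ₑ := hpair
        _ = (∫⁻ x in ball d 2, ‖localPressureNear d 2 u τ x‖ₑ * ‖u τ x‖ₑ * ‖gradient ψ x‖ₑ) +
              ∫⁻ x in ball d 2, ‖localPressureFar d 2 u τ x‖ₑ * ‖u τ x‖ₑ * ‖gradient ψ x‖ₑ := by
            rw [← lintegral_add_left' hmN]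
            refine lintegral_congr fun x => ?_
            ring
        _ ≤ _ := add_le_add le_rfl (hfar τ hτ)
    -- the near lemma applied to `Φ = ‖Q‖ - FB`
    have hΦ : ∀ᵐ τ ∂(volume.restrict (Ioo 0 s)), τ ∈ Ioo 0 s →
        ‖Q τ‖ₑ - FB τ ≤ ∫⁻ x in ball d 2, ‖localPressureNear d 2 u τ x‖ₑ * ‖u τ x‖ₑ * ‖gradient ψ x‖ₑ :=
      hQae.mono fun τ hτ hτs => tsub_le_iff_right.2 (hτ hτs)
    have hnear := hKN u G hG hum huC huG R hR1 d s hs.1 hs.2.le (fun τ => ‖Q τ‖ₑ - FB τ) hΦ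
    calc ‖∫ z in cyl, p z.1 z.2 * ⟪u z.1 z.2, gradient ψ z.2⟫‖ₑ = ‖∫ τ in Ioo 0 s, Q τ‖ₑ := by rw [hFub]
      _ ≤ ∫⁻ τ in Ioo 0 s, ‖Q τ‖ₑ := enorm_integral_le_lintegral_enorm _
      _ ≤ ∫⁻ τ in Ioo 0 s, ((‖Q τ‖ₑ - FB τ) + FB τ) := lintegral_mono fun τ => le_tsub_add
      _ = (∫⁻ τ in Ioo 0 s, (‖Q τ‖ₑ - FB τ)) + ∫⁻ τ in Ioo 0 s, FB τ := lintegral_add_right' _ hFBm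
      _ ≤ (KN : ℝ≥0∞) * (ENNReal.ofReal R⁻¹ + (⨆ c : EuclideanSpace ℝ (Fin 3), ∫⁻ z in Ioo 0 s ×ˢ ball c 1,
              ‖(1 - cutoff R z.2) • u z.1 z.2‖ₑ ^ 3) ^ (2 / 3 : ℝ)) +
            ((c₁ * ∫⁻ τ in Ioo 0 s, αR τ) + c₂ * ENNReal.ofReal s) := by
          refine add_le_add hnear (le_of_eq ?_)
          rw [hFB, lintegral_add_right' _ aemeasurable_const, lintegral_const_mul'' _ hαm, setLIntegral_const,
            Real.volume_Ioo, sub_zero]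
      _ ≤ _ := add_le_add le_rfl hfarint
  -- integrability of the non-pressure part of the flux on the big cylinder
  have hsq_T : ∫⁻ z in cylT, ‖u z.1 z.2‖ₑ ^ 2 < ⊤ :=
    lt_of_le_of_lt (lintegral_mono_set (prod_mono Subset.rfl ball_subset_closedBall))
      (hsq _ (isCompact_closedBall d 2))
  have hu2 : IntegrableOn (fun z : ℝ × EuclideanSpace ℝ (Fin 3) => ‖u z.1 z.2‖ ^ 2) cylT volume := by
    refine ⟨(continuous_norm.pow 2).comp_aestronglyMeasurable hmu_T, hasFiniteIntegral_iff_enorm.2 ?_⟩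
    refine lt_of_le_of_lt (lintegral_mono fun z => le_of_eq ?_) hsq_T
    rw [Real.enorm_eq_ofReal (by positivity), ENNReal.ofReal_pow (norm_nonneg _), ofReal_norm]
  have hA1 : IntegrableOn (fun z : ℝ × EuclideanSpace ℝ (Fin 3) => (ν * Δ ψ z.2) * ‖u z.1 z.2‖ ^ 2) cylT volume := by
    refine Integrable.bdd_mul (c := ν * (2 * KΔ)) hu2 ?_ (Eventually.of_forall fun z => ?_)
    · exact (continuous_const.mul ((continuous_laplacian (contDiff_sereginWeight φ₀ R d (n := 2))).comp
        continuous_snd)).aestronglyMeasurable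
    · rw [Real.norm_eq_abs, abs_mul, abs_of_nonneg hν.le]
      exact mul_le_mul_of_nonneg_left (hΔM z.2) hν.le
  have hA2 : IntegrableOn (fun z : ℝ × EuclideanSpace ℝ (Fin 3) => ‖u z.1 z.2‖ ^ 2 * ⟪u z.1 z.2, gradient ψ z.2⟫) cylT volume := by
    refine Integrable.mono' (hu3.const_mul (B₁ + 2 * C₁))
      (((continuous_norm.pow 2).comp_aestronglyMeasurable hmu_T).mul hg_m) (Eventually.of_forall fun z => ?_)
    rw [norm_mul, Real.norm_eq_abs, abs_of_nonneg (sq_nonneg _)]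
    calc ‖u z.1 z.2‖ ^ 2 * ‖⟪u z.1 z.2, gradient ψ z.2⟫‖
        ≤ ‖u z.1 z.2‖ ^ 2 * (‖u z.1 z.2‖ * (B₁ + 2 * C₁)) :=
          mul_le_mul_of_nonneg_left ((norm_inner_le_norm _ _).trans
            (mul_le_mul_of_nonneg_left (hgradM z.2) (norm_nonneg _))) (sq_nonneg _)
      _ = (B₁ + 2 * C₁) * ‖u z.1 z.2‖ ^ 3 := by ring
  -- the main estimate, a.e. in `s`
  filter_upwards [hLEI, ae_restrict_mem measurableSet_Ioo] with s hs hsI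
  set IA : ℝ≥0∞ := ∫⁻ τ in Ioo 0 s, ulocEnergy (fun x => (1 - cutoff R x) • u τ x) with hIA
  set γ : ℝ≥0∞ := (⨆ c : EuclideanSpace ℝ (Fin 3), ∫⁻ z in Ioo 0 s ×ˢ ball c 1, ‖(1 - cutoff R z.2) • u z.1 z.2‖ₑ ^ 3)
    with hγ
  set S : ℝ≥0∞ := (N : ℝ≥0∞) + ENNReal.ofReal R⁻¹ + IA + γ ^ (2 / 3 : ℝ) with hS
  set cyl : Set (ℝ × EuclideanSpace ℝ (Fin 3)) := Ioo 0 s ×ˢ ball d 2 with hcyl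
  have hcyl_sub : cyl ⊆ cylT := prod_mono (Ioo_subset_Ioo le_rfl hsI.2.le) Subset.rfl
  -- split the flux integral
  set Aflux : ℝ × EuclideanSpace ℝ (Fin 3) → ℝ := fun z => (ν * Δ ψ z.2) * ‖u z.1 z.2‖ ^ 2 +
    ‖u z.1 z.2‖ ^ 2 * ⟪u z.1 z.2, gradient ψ z.2⟫ with hAflux
  set Pflux : ℝ × EuclideanSpace ℝ (Fin 3) → ℝ := fun z => p z.1 z.2 * ⟪u z.1 z.2, gradient ψ z.2⟫ with hPflux
  have hAint : IntegrableOn Aflux cyl volume := (hA1.add hA2).mono_set hcyl_sub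
  have hPint : IntegrableOn Pflux cyl volume := hπv.mono_set hcyl_sub
  have hJ : ∫ z in cyl, (‖u z.1 z.2‖ ^ 2 * (ν * Δ ψ z.2) + (‖u z.1 z.2‖ ^ 2 + 2 * p z.1 z.2) *
      ⟪u z.1 z.2, gradient ψ z.2⟫) = (∫ z in cyl, Aflux z) + 2 * ∫ z in cyl, Pflux z := by
    rw [← integral_const_mul, ← integral_add hAint (hPint.const_mul 2)]
    refine integral_congr_ae (Eventually.of_forall fun z => ?_)
    simp only [hAflux, hPflux]
    ring
  -- the non-pressure flux
  have hAbound : ‖∫ z in cyl, Aflux z‖ₑ ≤ (KA : ℝ≥0∞) * (ENNReal.ofReal R⁻¹ + IA + γ ^ (2 / 3 : ℝ)) := by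
    refine (enorm_integral_le_lintegral_enorm _).trans ?_
    refine (lintegral_mono fun z => ?_).trans (hKA u G hG huC huG R hR1 d s hsI.1 hsI.2.le)
    simp only [hAflux]
    refine (enorm_add_le _ _).trans (add_le_add ?_ ?_)
    · rw [enorm_mul, Real.enorm_eq_ofReal_abs, abs_mul, abs_of_nonneg hν.le, Real.enorm_eq_ofReal (sq_nonneg _),
        ENNReal.ofReal_pow (norm_nonneg _), ofReal_norm, mul_comm]
    · have hinner : ‖⟪u z.1 z.2, gradient ψ z.2⟫‖ₑ ≤ ‖u z.1 z.2‖ₑ * ‖gradient ψ z.2‖ₑ := by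
        rw [← ofReal_norm (⟪u z.1 z.2, gradient ψ z.2⟫), ← ofReal_norm (u z.1 z.2), ← ofReal_norm (gradient ψ z.2),
          ← ENNReal.ofReal_mul (norm_nonneg _)]
        exact ENNReal.ofReal_le_ofReal (norm_inner_le_norm _ _)
      have hgn : ‖gradient ψ z.2‖ₑ = ‖fderiv ℝ ψ z.2‖ₑ := by
        rw [← ofReal_norm, norm_gradient_eq_norm_fderiv, ofReal_norm]
      calc ‖‖u z.1 z.2‖ ^ 2 * ⟪u z.1 z.2, gradient ψ z.2⟫‖ₑ = ‖u z.1 z.2‖ₑ ^ 2 * ‖⟪u z.1 z.2, gradient ψ z.2⟫‖ₑ := by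
            rw [enorm_mul, Real.enorm_eq_ofReal (sq_nonneg _), ENNReal.ofReal_pow (norm_nonneg _), ofReal_norm]
        _ ≤ ‖u z.1 z.2‖ₑ ^ 2 * (‖u z.1 z.2‖ₑ * ‖gradient ψ z.2‖ₑ) := mul_le_mul' le_rfl hinner
        _ = ‖u z.1 z.2‖ₑ ^ 3 * ‖fderiv ℝ ψ z.2‖ₑ := by rw [hgn]; ring
  -- assemble
  have h2 : ‖(2 : ℝ) * ∫ z in cyl, Pflux z‖ₑ = 2 * ‖∫ z in cyl, Pflux z‖ₑ := by
    rw [enorm_mul, Real.enorm_eq_ofReal zero_le_two, ENNReal.ofReal_ofNat]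
  have hcoe : (((nb : ℝ≥0) + KA + 2 * (KN + KF) : ℝ≥0) : ℝ≥0∞) = (nb : ℝ≥0∞) + KA + 2 * ((KN : ℝ≥0∞) + KF) := by
    push_cast; ring
  calc LHS s ≤ RHS s := hs
    _ = ENNReal.ofReal ((∫ x, ‖a x‖ ^ 2 * ψ x) + ((∫ z in cyl, Aflux z) + 2 * ∫ z in cyl, Pflux z)) := by
        rw [hRHS]; dsimp only; rw [hJ]
    _ ≤ ENNReal.ofReal (∫ x, ‖a x‖ ^ 2 * ψ x) + ENNReal.ofReal ((∫ z in cyl, Aflux z) + 2 * ∫ z in cyl, Pflux z) :=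
        ENNReal.ofReal_add_le
    _ ≤ (nb : ℝ≥0∞) * N + (‖∫ z in cyl, Aflux z‖ₑ + 2 * ‖∫ z in cyl, Pflux z‖ₑ) := by
        refine add_le_add hI₁ ?_
        calc ENNReal.ofReal ((∫ z in cyl, Aflux z) + 2 * ∫ z in cyl, Pflux z)
            ≤ ‖(∫ z in cyl, Aflux z) + 2 * ∫ z in cyl, Pflux z‖ₑ := by
              rw [Real.enorm_eq_ofReal_abs]; exact ENNReal.ofReal_le_ofReal (le_abs_self _)
          _ ≤ ‖∫ z in cyl, Aflux z‖ₑ + ‖(2 : ℝ) * ∫ z in cyl, Pflux z‖ₑ := enorm_add_le _ _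
          _ = _ := by rw [h2]
    _ ≤ (nb : ℝ≥0∞) * N + ((KA : ℝ≥0∞) * (ENNReal.ofReal R⁻¹ + IA + γ ^ (2 / 3 : ℝ)) +
          2 * ((KN : ℝ≥0∞) * (ENNReal.ofReal R⁻¹ + γ ^ (2 / 3 : ℝ)) + (KF : ℝ≥0∞) * (ENNReal.ofReal R⁻¹ + IA))) :=
        add_le_add le_rfl (add_le_add hAbound (mul_le_mul' le_rfl (hQ s hsI)))
    _ ≤ (nb : ℝ≥0∞) * S + ((KA : ℝ≥0∞) * S + 2 * ((KN : ℝ≥0∞) * S + (KF : ℝ≥0∞) * S)) := by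
        have i1 : (N : ℝ≥0∞) ≤ S := by rw [hS]; exact le_add_right (le_add_right le_self_add)
        have i2 : ENNReal.ofReal R⁻¹ + IA + γ ^ (2 / 3 : ℝ) ≤ S := by
          rw [hS, add_assoc, add_assoc, add_assoc]; exact le_add_self
        have i3 : ENNReal.ofReal R⁻¹ + γ ^ (2 / 3 : ℝ) ≤ S := by
          rw [hS]
          calc ENNReal.ofReal R⁻¹ + γ ^ (2 / 3 : ℝ) ≤ ((N : ℝ≥0∞) + ENNReal.ofReal R⁻¹ + IA) + γ ^ (2 / 3 : ℝ) :=
                add_le_add (le_add_right le_add_self) le_rfl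
            _ = _ := rfl
        have i4 : ENNReal.ofReal R⁻¹ + IA ≤ S := by
          rw [hS]
          calc ENNReal.ofReal R⁻¹ + IA ≤ (N : ℝ≥0∞) + ENNReal.ofReal R⁻¹ + IA := by
                rw [add_assoc]; exact le_add_self
            _ ≤ _ := le_self_add
        exact add_le_add (mul_le_mul' le_rfl i1) (add_le_add (mul_le_mul' le_rfl i2)
          (mul_le_mul' le_rfl (add_le_add (mul_le_mul' le_rfl i3) (mul_le_mul' le_rfl i4))))
    _ = (((nb : ℝ≥0) + KA + 2 * (KN + KF) : ℝ≥0) : ℝ≥0∞) * S := by rw [hcoe]; ring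

end Literature.Analysis.FluidPDE

end
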